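import Mathlib
import HarnessLib
import Summits.ValiantsHypothesis.ValiantsHypothesis.Theorems.LacunarySymmetroidMatrixDescartesOsculationLawCuspCubicCountPrelim
import Summits.ValiantsHypothesis.ValiantsHypothesis.Theorems.LacunarySymmetroidMatrixDescartesOsculationLawCuspQuarticPrelim

/-!
# ValiantsHypothesis / LacunarySymmetroid — crux `MatrixDescartes` (stmt-ValiantsHypothesis-18050, V1),
# line «osculation-law»: the MONIC QUARTIC cusp curve — the count in the CUBIC-REMAINDER regime with a
# QUADRATIC second remainder (`R₃ ≢ 0`, `ℓ₂ ≢ 0`)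

Regime A of the `(4,0)` case tree (desk RULING #260 (b)); the two-level Euclid cascade of
`OsculationCuspQuartic.euclid4_step1/euclid4_step2`:
`R₃²Φ = (R₃b + (σ₁R₃ − R₂))·R + ℓ`, `ℓ = ℓ₂b² + ℓ₁b + ℓ₀`; `ℓ₂²R = (R₃ℓ₂b + (R₂ℓ₂ − R₃ℓ₁))·ℓ + m₁b + m₀`;
resultant `N = ℓ₂m₀² − ℓ₁m₀m₁ + ℓ₀m₁²` (`= m₁²·ℓ(−m₀/m₁)`).  ABSTRACT in `σ₁ … σ₄ R₃ … R₀ : ℝ[X]`: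
`#osc ≤ |supp N| + 4(|supp R₃| + |supp ℓ₂| + |supp m₁| + |supp m₀|)`.
Strata: `{R₃(t)=0}`, `{ℓ₂(t)=0}`, `{m₁(t)=0}` / `{m₀(t)=0}` are fibres (≤ 4 ordinates, `fibre_four_le`); the generic
stratum (`b = −m₀/m₁`) injects into `Z₊(N)` or, if `N ≡ 0`, is an open arc of osculation points (absurd by
finiteness: `ℓ = 0 ⇒ R = 0 ⇒ Φ = 0` along the arc); if `m ≡ 0` then `ℓ(t,·)` divides `ℓ₂²R₃²Φ(t,·)`, hence is
real-rooted (`disc_nonneg_of_dvd_quartic`, Mathlib `Splits.of_dvd`) and a root branch `ρ(t)` of `ℓ` is an open arc of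
osculation points — absurd again.  Siblings: `…CuspQuarticCountLow` (`R₃ ≡ 0`), `…CuspQuarticCountHighLin`
(`R₃ ≢ 0`, `ℓ₂ ≡ 0`); the assembly with the `(4,0)` pencil (`osc_four_zero`) is the next file.

Honest framing: helper count for a located rung piece of an UNREGISTERED V1 law line; `OsculationLaw`,
`PeelInequality`, `MatrixDescartes`, Conjecture B and `VP ≠ VNP` are OPEN / NOT proved.  No definitions, no named facts.
-/

-- `Summit.ValiantsHypothesis.ValiantsHypothesis.…` is the tree's mandated single-conjunct layout (Sub = Summit).
set_option linter.dupNamespace false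

noncomputable section

namespace Summit.ValiantsHypothesis.ValiantsHypothesis.Theorems.LacunarySymmetroidMatrixDescartes

open Polynomial Set
open scoped BigOperators
open OsculationCuspCubic

namespace OsculationCuspQuartic

set_option maxHeartbeats 2400000 in
/-- **Quartic cusp curve, cubic remainder with quadratic second remainder — the count.**  See the module
docstring. [folklore] -/
theorem quartic_high_ncard_le (σ₁ σ₂ σ₃ σ₄ R₃ R₂ R₁ R₀ : ℝ[X]) (osc : Set (Fin 2 → ℝ)) (hR3 : R₃ ≠ 0)
    (hl2 : σ₂ * R₃ ^ 2 - R₁ * R₃ - σ₁ * R₂ * R₃ + R₂ ^ 2 ≠ 0)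
    (hout : ∀ p ∈ osc, 0 < p 0 ∧ 0 < p 1 ∧
      p 1 ^ 4 + p 1 ^ 3 * σ₁.eval (p 0) + p 1 ^ 2 * σ₂.eval (p 0) + p 1 * σ₃.eval (p 0) + σ₄.eval (p 0) = 0 ∧
      R₃.eval (p 0) * p 1 ^ 3 + R₂.eval (p 0) * p 1 ^ 2 + R₁.eval (p 0) * p 1 + R₀.eval (p 0) = 0)
    (hin : ∀ t b : ℝ, 0 < t → 0 < b →
      b ^ 4 + b ^ 3 * σ₁.eval t + b ^ 2 * σ₂.eval t + b * σ₃.eval t + σ₄.eval t = 0 →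
      R₃.eval t * b ^ 3 + R₂.eval t * b ^ 2 + R₁.eval t * b + R₀.eval t = 0 → (![t, b] : Fin 2 → ℝ) ∈ osc)
    (hreal : ∀ t : ℝ, ∃ μ₁ μ₂ μ₃ μ₄ : ℝ, ∀ b : ℝ,
      b ^ 4 + b ^ 3 * σ₁.eval t + b ^ 2 * σ₂.eval t + b * σ₃.eval t + σ₄.eval t
        = (b - μ₁) * (b - μ₂) * (b - μ₃) * (b - μ₄))
    (hfin : osc.Finite) :
    osc.ncard ≤
      ((σ₂ * R₃ ^ 2 - R₁ * R₃ - σ₁ * R₂ * R₃ + R₂ ^ 2)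
          * (R₀ * (σ₂ * R₃ ^ 2 - R₁ * R₃ - σ₁ * R₂ * R₃ + R₂ ^ 2) ^ 2
              - R₂ * (σ₄ * R₃ ^ 2 - σ₁ * R₀ * R₃ + R₀ * R₂) * (σ₂ * R₃ ^ 2 - R₁ * R₃ - σ₁ * R₂ * R₃ + R₂ ^ 2)
              + R₃ * (σ₄ * R₃ ^ 2 - σ₁ * R₀ * R₃ + R₀ * R₂) * (σ₃ * R₃ ^ 2 - R₀ * R₃ - σ₁ * R₁ * R₃ + R₁ * R₂)) ^ 2
        - (σ₃ * R₃ ^ 2 - R₀ * R₃ - σ₁ * R₁ * R₃ + R₁ * R₂)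
          * (R₀ * (σ₂ * R₃ ^ 2 - R₁ * R₃ - σ₁ * R₂ * R₃ + R₂ ^ 2) ^ 2
              - R₂ * (σ₄ * R₃ ^ 2 - σ₁ * R₀ * R₃ + R₀ * R₂) * (σ₂ * R₃ ^ 2 - R₁ * R₃ - σ₁ * R₂ * R₃ + R₂ ^ 2)
              + R₃ * (σ₄ * R₃ ^ 2 - σ₁ * R₀ * R₃ + R₀ * R₂) * (σ₃ * R₃ ^ 2 - R₀ * R₃ - σ₁ * R₁ * R₃ + R₁ * R₂))
          * (R₁ * (σ₂ * R₃ ^ 2 - R₁ * R₃ - σ₁ * R₂ * R₃ + R₂ ^ 2) ^ 2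
              - R₃ * (σ₄ * R₃ ^ 2 - σ₁ * R₀ * R₃ + R₀ * R₂) * (σ₂ * R₃ ^ 2 - R₁ * R₃ - σ₁ * R₂ * R₃ + R₂ ^ 2)
              - R₂ * (σ₃ * R₃ ^ 2 - R₀ * R₃ - σ₁ * R₁ * R₃ + R₁ * R₂) * (σ₂ * R₃ ^ 2 - R₁ * R₃ - σ₁ * R₂ * R₃ + R₂ ^ 2)
              + R₃ * (σ₃ * R₃ ^ 2 - R₀ * R₃ - σ₁ * R₁ * R₃ + R₁ * R₂) ^ 2)
        + (σ₄ * R₃ ^ 2 - σ₁ * R₀ * R₃ + R₀ * R₂)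
          * (R₁ * (σ₂ * R₃ ^ 2 - R₁ * R₃ - σ₁ * R₂ * R₃ + R₂ ^ 2) ^ 2
              - R₃ * (σ₄ * R₃ ^ 2 - σ₁ * R₀ * R₃ + R₀ * R₂) * (σ₂ * R₃ ^ 2 - R₁ * R₃ - σ₁ * R₂ * R₃ + R₂ ^ 2)
              - R₂ * (σ₃ * R₃ ^ 2 - R₀ * R₃ - σ₁ * R₁ * R₃ + R₁ * R₂) * (σ₂ * R₃ ^ 2 - R₁ * R₃ - σ₁ * R₂ * R₃ + R₂ ^ 2)
              + R₃ * (σ₃ * R₃ ^ 2 - R₀ * R₃ - σ₁ * R₁ * R₃ + R₁ * R₂) ^ 2) ^ 2).support.card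
      + 4 * (R₃.support.card + (σ₂ * R₃ ^ 2 - R₁ * R₃ - σ₁ * R₂ * R₃ + R₂ ^ 2).support.card
          + (R₁ * (σ₂ * R₃ ^ 2 - R₁ * R₃ - σ₁ * R₂ * R₃ + R₂ ^ 2) ^ 2
              - R₃ * (σ₄ * R₃ ^ 2 - σ₁ * R₀ * R₃ + R₀ * R₂) * (σ₂ * R₃ ^ 2 - R₁ * R₃ - σ₁ * R₂ * R₃ + R₂ ^ 2)
              - R₂ * (σ₃ * R₃ ^ 2 - R₀ * R₃ - σ₁ * R₁ * R₃ + R₁ * R₂) * (σ₂ * R₃ ^ 2 - R₁ * R₃ - σ₁ * R₂ * R₃ + R₂ ^ 2)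
              + R₃ * (σ₃ * R₃ ^ 2 - R₀ * R₃ - σ₁ * R₁ * R₃ + R₁ * R₂) ^ 2).support.card
          + (R₀ * (σ₂ * R₃ ^ 2 - R₁ * R₃ - σ₁ * R₂ * R₃ + R₂ ^ 2) ^ 2
              - R₂ * (σ₄ * R₃ ^ 2 - σ₁ * R₀ * R₃ + R₀ * R₂) * (σ₂ * R₃ ^ 2 - R₁ * R₃ - σ₁ * R₂ * R₃ + R₂ ^ 2)
              + R₃ * (σ₄ * R₃ ^ 2 - σ₁ * R₀ * R₃ + R₀ * R₂)
                * (σ₃ * R₃ ^ 2 - R₀ * R₃ - σ₁ * R₁ * R₃ + R₁ * R₂)).support.card) := by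
  classical
  set P₂ : ℝ[X] := σ₂ * R₃ ^ 2 - R₁ * R₃ - σ₁ * R₂ * R₃ + R₂ ^ 2 with hP₂def
  set P₁ : ℝ[X] := σ₃ * R₃ ^ 2 - R₀ * R₃ - σ₁ * R₁ * R₃ + R₁ * R₂ with hP₁def
  set P₀ : ℝ[X] := σ₄ * R₃ ^ 2 - σ₁ * R₀ * R₃ + R₀ * R₂ with hP₀def
  set M₁ : ℝ[X] := R₁ * P₂ ^ 2 - R₃ * P₀ * P₂ - R₂ * P₁ * P₂ + R₃ * P₁ ^ 2 with hM₁def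
  set M₀ : ℝ[X] := R₀ * P₂ ^ 2 - R₂ * P₀ * P₂ + R₃ * P₀ * P₁ with hM₀def
  set N : ℝ[X] := P₂ * M₀ ^ 2 - P₁ * M₀ * M₁ + P₀ * M₁ ^ 2 with hNdef
  have hpos0 : ∀ p ∈ osc, 0 < p 0 := fun p hp => (hout p hp).1
  have hpos1 : ∀ p ∈ osc, 0 < p 1 := fun p hp => (hout p hp).2.1
  have hcub : ∀ p ∈ osc,
      p 1 ^ 4 + p 1 ^ 3 * σ₁.eval (p 0) + p 1 ^ 2 * σ₂.eval (p 0) + p 1 * σ₃.eval (p 0) + σ₄.eval (p 0) = 0 :=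
    fun p hp => (hout p hp).2.2.1
  have hR : ∀ p ∈ osc,
      R₃.eval (p 0) * p 1 ^ 3 + R₂.eval (p 0) * p 1 ^ 2 + R₁.eval (p 0) * p 1 + R₀.eval (p 0) = 0 :=
    fun p hp => (hout p hp).2.2.2
  -- the two cascade identities, evaluated
  have hE1 : ∀ t b : ℝ,
      R₃.eval t ^ 2 * (b ^ 4 + b ^ 3 * σ₁.eval t + b ^ 2 * σ₂.eval t + b * σ₃.eval t + σ₄.eval t) =
      (R₃.eval t * b + (σ₁.eval t * R₃.eval t - R₂.eval t))
        * (R₃.eval t * b ^ 3 + R₂.eval t * b ^ 2 + R₁.eval t * b + R₀.eval t)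
        + (P₂.eval t * b ^ 2 + P₁.eval t * b + P₀.eval t) := by
    intro t b
    rw [hP₂def, hP₁def, hP₀def]
    simp only [eval_add, eval_sub, eval_mul, eval_pow]
    ring
  have hE2 : ∀ t b : ℝ,
      P₂.eval t ^ 2 * (R₃.eval t * b ^ 3 + R₂.eval t * b ^ 2 + R₁.eval t * b + R₀.eval t) =
      (R₃.eval t * P₂.eval t * b + (R₂.eval t * P₂.eval t - R₃.eval t * P₁.eval t))
        * (P₂.eval t * b ^ 2 + P₁.eval t * b + P₀.eval t)
        + (M₁.eval t * b + M₀.eval t) := by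
    intro t b
    rw [hM₁def, hM₀def]
    simp only [eval_add, eval_sub, eval_mul, eval_pow]
    ring
  have hNq : ∀ t b : ℝ, M₁.eval t * b + M₀.eval t = 0 →
      N.eval t = M₁.eval t ^ 2 * (P₂.eval t * b ^ 2 + P₁.eval t * b + P₀.eval t) := by
    intro t b h
    have h0 : M₀.eval t = -(M₁.eval t * b) := by linarith
    rw [hNdef]
    simp only [eval_add, eval_sub, eval_mul, eval_pow]
    rw [h0]
    ring
  have hL : ∀ p ∈ osc, P₂.eval (p 0) * p 1 ^ 2 + P₁.eval (p 0) * p 1 + P₀.eval (p 0) = 0 := by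
    intro p hp
    have h := hE1 (p 0) (p 1)
    rw [hcub p hp, hR p hp, mul_zero, mul_zero, zero_add] at h
    exact h.symm
  have hM : ∀ p ∈ osc, M₁.eval (p 0) * p 1 + M₀.eval (p 0) = 0 := by
    intro p hp
    have h := hE2 (p 0) (p 1)
    rw [hR p hp, hL p hp, mul_zero, mul_zero, zero_add] at h
    exact h.symm
  have hNroot : ∀ p ∈ osc, N.IsRoot (p 0) := by
    intro p hp
    rw [IsRoot.def, hNq (p 0) (p 1) (hM p hp), hL p hp, mul_zero]
  -- recovering `R = 0` and `Φ = 0` from `ℓ = 0` on the generic stratum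
  have hback : ∀ t b : ℝ, R₃.eval t ≠ 0 → P₂.eval t ≠ 0 →
      P₂.eval t * b ^ 2 + P₁.eval t * b + P₀.eval t = 0 → M₁.eval t * b + M₀.eval t = 0 →
      (R₃.eval t * b ^ 3 + R₂.eval t * b ^ 2 + R₁.eval t * b + R₀.eval t = 0) ∧
      (b ^ 4 + b ^ 3 * σ₁.eval t + b ^ 2 * σ₂.eval t + b * σ₃.eval t + σ₄.eval t = 0) := by
    intro t b hR3t hP2t hl hm
    have hq : R₃.eval t * b ^ 3 + R₂.eval t * b ^ 2 + R₁.eval t * b + R₀.eval t = 0 := by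
      have h := hE2 t b
      rw [hl, hm, mul_zero, zero_add] at h
      rcases mul_eq_zero.1 h with h' | h'
      · exact absurd ((pow_eq_zero_iff (by norm_num)).1 h') hP2t
      · exact h'
    refine ⟨hq, ?_⟩
    have h := hE1 t b
    rw [hq, hl, mul_zero, zero_add] at h
    rcases mul_eq_zero.1 h with h' | h'
    · exact absurd ((pow_eq_zero_iff (by norm_num)).1 h') hR3t
    · exact h'
  rcases Set.eq_empty_or_nonempty osc with hempty | hne
  · rw [hempty, Set.ncard_empty]; exact Nat.zero_le _
  set S0 : Set (Fin 2 → ℝ) := {p | p ∈ osc ∧ R₃.eval (p 0) = 0} with hS0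
  set S1 : Set (Fin 2 → ℝ) := {p | p ∈ osc ∧ R₃.eval (p 0) ≠ 0 ∧ P₂.eval (p 0) = 0} with hS1
  set S2 : Set (Fin 2 → ℝ) :=
    {p | p ∈ osc ∧ R₃.eval (p 0) ≠ 0 ∧ P₂.eval (p 0) ≠ 0 ∧ M₁.eval (p 0) ≠ 0} with hS2
  set S3 : Set (Fin 2 → ℝ) :=
    {p | p ∈ osc ∧ R₃.eval (p 0) ≠ 0 ∧ P₂.eval (p 0) ≠ 0 ∧ M₁.eval (p 0) = 0} with hS3
  have hsplit : osc = S0 ∪ S1 ∪ S2 ∪ S3 := by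
    refine Set.Subset.antisymm ?_ ?_
    · intro p hp
      by_cases h3 : R₃.eval (p 0) = 0
      · exact Or.inl (Or.inl (Or.inl ⟨hp, h3⟩))
      by_cases h2 : P₂.eval (p 0) = 0
      · exact Or.inl (Or.inl (Or.inr ⟨hp, h3, h2⟩))
      by_cases h1 : M₁.eval (p 0) = 0
      · exact Or.inr ⟨hp, h3, h2, h1⟩
      · exact Or.inl (Or.inr ⟨hp, h3, h2, h1⟩)
    · rintro p (((⟨hp, -⟩ | ⟨hp, -⟩) | ⟨hp, -⟩) | ⟨hp, -⟩) <;> exact hp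
  have hS0c : S0.ncard ≤ 4 * R₃.support.card :=
    fibre_four_le σ₁ σ₂ σ₃ σ₄ R₃ hR3 S0 (fun p hp => ⟨hpos0 p hp.1, hp.2, hcub p hp.1⟩)
  have hS1c : S1.ncard ≤ 4 * P₂.support.card :=
    fibre_four_le σ₁ σ₂ σ₃ σ₄ P₂ hl2 S1 (fun p hp => ⟨hpos0 p hp.1, hp.2.2, hcub p hp.1⟩)
  -- generic stratum: `b = −m₀/m₁`, abscissae in `Z₊(N)`
  have hS2c : S2.ncard ≤ N.support.card := by
    by_cases hNz : N = 0
    · have hS2e : S2 = ∅ := by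
        rcases Set.eq_empty_or_nonempty S2 with h | ⟨p, hp⟩
        · exact h
        exfalso
        have hR3p : R₃.eval (p 0) ≠ 0 := hp.2.1
        have hP2p : P₂.eval (p 0) ≠ 0 := hp.2.2.1
        have hM1p : M₁.eval (p 0) ≠ 0 := hp.2.2.2
        have hlin := hM p hp.1
        have hb := hpos1 p hp.1
        apply hfin.not_infinite
        have hc : Continuous fun t => M₀.eval t * M₁.eval t := M₀.continuous.mul M₁.continuous
        have hV : IsOpen {t : ℝ | R₃.eval t ≠ 0} := isOpen_ne_fun R₃.continuous continuous_const
        have hV' : IsOpen {t : ℝ | P₂.eval t ≠ 0} := isOpen_ne_fun P₂.continuous continuous_const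
        refine OsculationCusp.infinite_of_curve
          (U := ({t | 0 < t ∧ M₀.eval t * M₁.eval t < 0} ∩ {t : ℝ | R₃.eval t ≠ 0}) ∩ {t : ℝ | P₂.eval t ≠ 0})
          ((((isOpen_lt continuous_const continuous_id).inter (isOpen_lt hc continuous_const)).inter hV).inter hV')
          (t₀ := p 0) ⟨⟨⟨hpos0 p hp.1, ?_⟩, hR3p⟩, hP2p⟩ (fun t => -(M₀.eval t) / M₁.eval t) ?_
        · have h0 : M₀.eval (p 0) = -(M₁.eval (p 0) * p 1) := by linarith
          rw [h0]
          nlinarith [mul_self_pos.2 hM1p]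
        · intro t ht
          obtain ⟨⟨⟨htpos, hprod⟩, hR3t⟩, hP2t⟩ := ht
          have hM1t : M₁.eval t ≠ 0 := by
            intro h0; rw [h0, mul_zero] at hprod; exact lt_irrefl _ hprod
          have hm : M₁.eval t * (-(M₀.eval t) / M₁.eval t) + M₀.eval t = 0 := by
            field_simp; ring
          have hl : P₂.eval t * (-(M₀.eval t) / M₁.eval t) ^ 2 + P₁.eval t * (-(M₀.eval t) / M₁.eval t)
              + P₀.eval t = 0 := by
            have hNt : N.eval t = 0 := by rw [hNz, eval_zero]
            rw [hNq t _ hm] at hNt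
            rcases mul_eq_zero.1 hNt with h | h
            · exact absurd ((pow_eq_zero_iff (by norm_num)).1 h) hM1t
            · exact h
          obtain ⟨hq, hquart⟩ := hback t _ hR3t hP2t hl hm
          have hbpos : 0 < -(M₀.eval t) / M₁.eval t := by
            have h1 : -(M₀.eval t) / M₁.eval t = (-(M₀.eval t * M₁.eval t)) / (M₁.eval t * M₁.eval t) := by
              field_simp
            rw [h1]
            exact div_pos (by linarith) (mul_self_pos.2 hM1t)
          exact hin t _ htpos hbpos hquart hq
      rw [hS2e, Set.ncard_empty]; exact Nat.zero_le _
    · refine inj_le N hNz S2 (fun p hp => ⟨hpos0 p hp.1, hNroot p hp.1⟩) ?_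
      intro p hp q hq hpq
      have h1 := hM p hp.1
      have h2 := hM q hq.1
      rw [← hpq] at h2
      have h3 : M₁.eval (p 0) * (p 1 - q 1) = 0 := by linarith
      rcases mul_eq_zero.1 h3 with h | h
      · exact absurd h hp.2.2.2
      · linarith
  -- the stratum `m₁(t) = 0`
  have hS3c : S3.ncard ≤ 4 * (M₁.support.card + M₀.support.card) := by
    by_cases hM1z : M₁ = 0
    · have hM0v : ∀ p ∈ osc, M₀.eval (p 0) = 0 := by
        intro p hp
        have h := hM p hp
        rw [hM1z, eval_zero, zero_mul, zero_add] at h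
        exact h
      by_cases hM0z : M₀ = 0
      · /- `m ≡ 0`: `ℓ(t,·)` divides `ℓ₂²R₃²Φ(t,·)`; a root branch of `ℓ` is an open arc of osculation points -/
        have hS3e : S3 = ∅ := by
          rcases Set.eq_empty_or_nonempty S3 with h | ⟨p, hp⟩
          · exact h
          exfalso
          have hR3p : R₃.eval (p 0) ≠ 0 := hp.2.1
          have hP2p : P₂.eval (p 0) ≠ 0 := hp.2.2.1
          have hb := hpos1 p hp.1
          have hm0 : ∀ t b : ℝ, M₁.eval t * b + M₀.eval t = 0 := by
            intro t b; rw [hM1z, hM0z, eval_zero]; ring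
          -- the factorisation `ℓ₂² R₃² Φ = K·ℓ`
          have hid : ∀ t b : ℝ,
              (R₃.eval t ^ 2 * P₂.eval t * b ^ 2
                + (R₃.eval t * (R₂.eval t * P₂.eval t - R₃.eval t * P₁.eval t)
                    + (σ₁.eval t * R₃.eval t - R₂.eval t) * (R₃.eval t * P₂.eval t)) * b
                + ((σ₁.eval t * R₃.eval t - R₂.eval t) * (R₂.eval t * P₂.eval t - R₃.eval t * P₁.eval t)
                    + P₂.eval t ^ 2))
                * (P₂.eval t * b ^ 2 + P₁.eval t * b + P₀.eval t) =
              (P₂.eval t ^ 2 * R₃.eval t ^ 2)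
                * (b ^ 4 + b ^ 3 * σ₁.eval t + b ^ 2 * σ₂.eval t + b * σ₃.eval t + σ₄.eval t) := by
            intro t b
            have h1 := hE1 t b
            have h2 := hE2 t b
            rw [hm0 t b, add_zero] at h2
            linear_combination (-(P₂.eval t ^ 2)) * h1
              - (R₃.eval t * b + (σ₁.eval t * R₃.eval t - R₂.eval t)) * h2
          have hD : ∀ t : ℝ, R₃.eval t ≠ 0 → P₂.eval t ≠ 0 →
              0 ≤ P₁.eval t ^ 2 - 4 * P₂.eval t * P₀.eval t := by
            intro t hR3t hP2t
            obtain ⟨μ₁, μ₂, μ₃, μ₄, hμ⟩ := hreal t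
            have h4 := disc_nonneg_of_dvd_quartic (μ₁ := μ₁) (μ₂ := μ₂) (μ₃ := μ₃) (μ₄ := μ₄) hP2t
              (mul_ne_zero (pow_ne_zero 2 hP2t) (pow_ne_zero 2 hR3t)) (fun b => by rw [← hμ b]; exact hid t b)
            linarith
          -- the branch through `p`
          obtain ⟨ε, hε, hpε⟩ : ∃ ε : ℝ, (ε = 1 ∨ ε = -1) ∧
              p 1 = (-P₁.eval (p 0) + ε * Real.sqrt (P₁.eval (p 0) ^ 2 - 4 * P₂.eval (p 0) * P₀.eval (p 0)))
                / (2 * P₂.eval (p 0)) := by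
            rcases root_formula hP2p (hD _ hR3p hP2p) (hL p hp.1) with h | h
            · exact ⟨1, Or.inl rfl, by rw [one_mul]; exact h⟩
            · exact ⟨-1, Or.inr rfl, by rw [neg_one_mul, ← sub_eq_add_neg]; exact h⟩
          set ρ : ℝ → ℝ := fun t =>
            (-P₁.eval t + ε * Real.sqrt (P₁.eval t ^ 2 - 4 * P₂.eval t * P₀.eval t)) / (2 * P₂.eval t) with hρ
          have hV : IsOpen {t : ℝ | R₃.eval t ≠ 0} := isOpen_ne_fun R₃.continuous continuous_const
          have hV' : IsOpen {t : ℝ | P₂.eval t ≠ 0} := isOpen_ne_fun P₂.continuous continuous_const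
          have hρc : ContinuousOn ρ {t : ℝ | P₂.eval t ≠ 0} := by
            have hnum : Continuous fun t => -P₁.eval t
                + ε * Real.sqrt (P₁.eval t ^ 2 - 4 * P₂.eval t * P₀.eval t) :=
              P₁.continuous.neg.add (continuous_const.mul
                (((P₁.continuous.pow 2).sub ((continuous_const.mul P₂.continuous).mul P₀.continuous)).sqrt))
            have hden : Continuous fun t => 2 * P₂.eval t := continuous_const.mul P₂.continuous
            exact hnum.continuousOn.div hden.continuousOn (fun t ht => mul_ne_zero two_ne_zero ht)
          apply hfin.not_infinite
          refine OsculationCusp.infinite_of_curve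
            (U := Set.Ioi 0 ∩ ({t : ℝ | R₃.eval t ≠ 0} ∩ ({t : ℝ | P₂.eval t ≠ 0} ∩ ρ ⁻¹' Set.Ioi 0)))
            (isOpen_Ioi.inter (hV.inter (hρc.isOpen_inter_preimage hV' isOpen_Ioi)))
            (t₀ := p 0) ⟨hpos0 p hp.1, hR3p, hP2p, ?_⟩ ρ ?_
          · show 0 < ρ (p 0)
            rw [hρ]; dsimp only; rw [← hpε]; exact hb
          · intro t ht
            obtain ⟨htpos, hR3t, hP2t, hρpos⟩ := ht
            have hl : P₂.eval t * ρ t ^ 2 + P₁.eval t * ρ t + P₀.eval t = 0 := by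
              rw [hρ]; exact root_of_formula hP2t (hD t hR3t hP2t) hε
            obtain ⟨hq, hquart⟩ := hback t _ hR3t hP2t hl (hm0 t _)
            exact hin t (ρ t) htpos hρpos hquart hq
        rw [hS3e, Set.ncard_empty]; exact Nat.zero_le _
      · have h := fibre_four_le σ₁ σ₂ σ₃ σ₄ M₀ hM0z S3 (fun p hp => ⟨hpos0 p hp.1, hM0v p hp.1, hcub p hp.1⟩)
        nlinarith [h, Nat.zero_le M₁.support.card]
    · have h := fibre_four_le σ₁ σ₂ σ₃ σ₄ M₁ hM1z S3 (fun p hp => ⟨hpos0 p hp.1, hp.2.2.2, hcub p hp.1⟩)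
      nlinarith [h, Nat.zero_le M₀.support.card]
  calc osc.ncard = (S0 ∪ S1 ∪ S2 ∪ S3).ncard := by rw [← hsplit]
    _ ≤ (S0 ∪ S1 ∪ S2).ncard + S3.ncard := Set.ncard_union_le _ _
    _ ≤ (S0 ∪ S1).ncard + S2.ncard + S3.ncard := Nat.add_le_add_right (Set.ncard_union_le _ _) _
    _ ≤ S0.ncard + S1.ncard + S2.ncard + S3.ncard :=
        Nat.add_le_add_right (Nat.add_le_add_right (Set.ncard_union_le _ _) _) _
    _ ≤ 4 * R₃.support.card + 4 * P₂.support.card + N.support.card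
          + 4 * (M₁.support.card + M₀.support.card) :=
        Nat.add_le_add (Nat.add_le_add (Nat.add_le_add hS0c hS1c) hS2c) hS3c
    _ = _ := by ring

end OsculationCuspQuartic

end Summit.ValiantsHypothesis.ValiantsHypothesis.Theorems.LacunarySymmetroidMatrixDescartes
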